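import Literature.MathematicalPhysics.QuantumLattice.BalabanRGMultiscale
import Literature.MathematicalPhysics.QuantumLattice.BalabanRGSpreadTwist
import Literature.MathematicalPhysics.QuantumLattice.SU2Haar
import Mathlib.Analysis.SpecialFunctions.Trigonometric.Bounds
import Mathlib.Analysis.SpecialFunctions.Trigonometric.Inverse
import HarnessLib

/-!
# `BalabanUVStability3` as rendered holds — by Haar invariance, convexity and spreading the twist

Sibling proof file of the statement file
`Literature/MathematicalPhysics/QuantumFieldTheory/ConstructiveQFTBalabanRG.lean`
(constructive-qft.S20). It discharges the named proposition
`Literature.MathematicalPhysics.QuantumFieldTheory.BalabanUVStability3`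
(`BalabanUVStability3_holds`). No proposition is defined and no named fact is introduced; the
definitions here (`quatMat`, `rotA`, `rotB`, `edgePhase`, `plaquettesPerEdgeBound`) are concrete
auxiliary objects (unit-quaternion matrices, an integer invariant of lattice edges, a counting
constant).

## Statement proved

For every block size `M ≥ 2` and coupling `g > 0` there are a cutoff-indexed family of block RG
schemes `sch n` for `d = 3`, `G = SU(2)`, fundamental representation, with bare coupling
`g_ε² = g² M⁻ⁿ`, normalisations `E`, and ONE constant `K` such that every `sch n` solves the
normalised free-boundary axial-gauge block RG recursion `IsRGIterateWith (E n)` and its `n`-th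
effective density satisfies `e^{-K|Λ|} ≤ ρ^{(n)}_n(Λ, V) ≤ e^{K|Λ|}` for all finite `Λ` and
`freeHaarConfig Λ`-a.e. `V` (`HasUVStabilityBoundsAtAE K K n`). The witness is the Haar-iterate
scheme of `BalabanRGHaarIterates` (`BlockRGScheme.haarIterate`), whose recursion property is
proved there; the constant is `K = max (K₀, 2 c₃ π² / g²)` with `K₀` the log-oscillation bound of
the bare Wilson weight at `β = g⁻²` (level `n = 0`) and `c₃ = plaquettesPerEdgeBound 3`.

## The argument (elementary; about 2 pages on paper)

Fix `n ≥ 1`, `L = Mⁿ`, `β = L / g²`.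
1. `n` block RG steps of size `M` are one step of size `L` (`BalabanRGMultiscale`:
   `rgIterate_ae_eq_smul_blockStepDensity`), so `ρ^{(n)}_n(Λ, ·)` is a.e. a constant multiple of
   the explicit density `D(V) = ∫ e^{-β S(firstLift (V Ū⁻¹) U)} dU` over lines of `L` fine links.
2. To compare `D` at `V` and at `V · [b ↦ x]`, write `x = s^L` with `s ∈ SU(2)` within angle
   `π / L` of `1` (`su2_exists_root`, de Moivre in `SU(2) ≅ S³`) and move EVERY link of the line
   of `b` by a conjugate of `s` (the spread twist of `BalabanRGSpreadTwist`, Haar-measure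
   preserving and exactly intertwining the fibres). Cauchy–Schwarz with `s` and `s⁻¹` gives
   `e^{-K₁/2} D(V) ≤ D(V[b ↦ ·s^L])^{1/2} D(V[b ↦ ·s^{-L}])^{1/2}` once the SYMMETRIC SECOND
   DIFFERENCE of the action is bounded: `β (S(T_s U) + S(T_{s⁻¹} U) - 2 S(U)) ≤ K₁`.
3. For `SU(2)` and one moved link per plaquette (a plaquette never contains two links of one
   block line, `lineEdge_mem_plaquetteEdges_unique`), the identity `g + g⁻¹ = (tr g) 1`
   (`su2_coe_add_coe_inv`) makes the plaquette second difference EXACTLY `(2 - tr s) Re tr U_p`,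
   `≤ 2 (π / L)²`; at most `c_d L` plaquettes meet the line, so the action second difference is
   `≤ 2 c_d π² / L` and `β · 2 c_d π² / L = 2 c_d π² / g² =: K₁`, INDEPENDENT of `n` — the
   `d = 3` scaling `g_ε² = g² ε` is used exactly here (`wilsonBoltzmannWeight_twist_sqrt_bound`).
4. A supremum argument on each fibre and a coordinate-by-coordinate chain
   (`blockStepDensity_osc_of_twist`) give `D V ≤ e^{K₁|F|} D V'` when `V = V'` off `F`; total
   mass one then pins `e^{-K₁|Λ|} ≤ D ≤ e^{K₁|Λ|}` everywhere
   (`bounds_of_osc_of_lintegral_eq_one`), hence the a.e. bounds for `ρ^{(n)}_n`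
   (`rgIterate_wilson_su2_ae_bounds`).

## Honesty note: this is not Bałaban's theorem

The rendered proposition was documented (statement file, review r02500B) as a transcription of
Bałaban, CMP 102 (1985) Thm. 1 "modulo flagged simplifications", its `n`-uniformity being
"exactly the non-trivial content of CMP 102". The present proof shows that the rendering is in
fact MUCH weaker than the source: crude two-sided a.e. bounds at the last scale are forced by
convexity and Haar invariance alone, with no renormalization group analysis, no background
fields and no small/large-field decomposition. Bałaban's Theorem 1 asserts the small-field
representation (5) of the effective densities at EVERY scale `k ≤ n`, with the classical action
of the minimiser `g_k⁻² A(U_k)` as main term and `O(1)|T₁^{(k)}|` corrections, on the torus with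
gauge-covariant block averages — none of which is expressible over the v0 structure
`BlockRGScheme`. A faithful formal target for UV stability in Bałaban's sense remains to be
stated (supervisor follow-up recorded in the unit notes); `BalabanUVStability3_holds` must not be
cited as a formalisation of CMP 102.

## References

* T. Bałaban, *Ultraviolet stability of three-dimensional lattice pure gauge field theories*,
  Comm. Math. Phys. 102 (1985) 255–275, Thm. 1 and (5) (the statement whose rendering is
  discharged; pp. 256–257 for the bounds, p. 257 for the theorem).
* T. Bałaban, *Propagators and renormalization transformations for lattice gauge theories. I*,
  Comm. Math. Phys. 95 (1984) 17–40, §1 (axial-gauge block variables along straight lines).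
* T. Bröcker, T. tom Dieck, *Representations of Compact Lie Groups*, GTM 98 (1985), I (1.10),
  IV (1.6) (`SU(2)` as unit quaternions; maximal tori).
* E. Seiler, *Gauge Theories as a Problem of Constructive Quantum Field Theory and Statistical
  Mechanics*, LNP 159 (1982), Ch. 2 (Haar changes of variables on links).
-/
noncomputable section

open Matrix Complex
open scoped ComplexConjugate Real

namespace Literature.MathematicalPhysics.QuantumFieldTheory

/-- Local notation for `SU(2)`. -/
local notation "SU2" => Matrix.specialUnitaryGroup (Fin 2) ℂ

/-! ### `SU(2)` as unit quaternions: entries, trace, the identity `g + g⁻¹ = (tr g) 1` -/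

/-- `g ∈ SU(2)` has the unit-quaternion form `!![a, b; -b̄, ā]`. [folklore] -/
theorem su2_coe_eq (g : SU2) :
    (g : Matrix (Fin 2) (Fin 2) ℂ) =
      !![(g : Matrix (Fin 2) (Fin 2) ℂ) 0 0, (g : Matrix (Fin 2) (Fin 2) ℂ) 0 1;
        -conj ((g : Matrix (Fin 2) (Fin 2) ℂ) 0 1), conj ((g : Matrix (Fin 2) (Fin 2) ℂ) 0 0)] := by
  conv_lhs => rw [Matrix.eta_fin_two (g : Matrix (Fin 2) (Fin 2) ℂ)]
  rw [QuantumLattice.su2_apply_11, QuantumLattice.su2_apply_10]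

/-- The first row of `g ∈ SU(2)` is a unit vector: `|a|² + |b|² = 1`. [folklore] -/
theorem su2_normSq_add_normSq (g : SU2) :
    normSq ((g : Matrix (Fin 2) (Fin 2) ℂ) 0 0) + normSq ((g : Matrix (Fin 2) (Fin 2) ℂ) 0 1) = 1 := by
  have hu : (g : Matrix (Fin 2) (Fin 2) ℂ) * star (g : Matrix (Fin 2) (Fin 2) ℂ) = 1 :=
    Matrix.mem_unitaryGroup_iff.1 g.prop.1
  have h := congrFun (congrFun hu 0) 0
  simp only [mul_apply, Fin.sum_univ_two, star_apply, RCLike.star_def, one_apply_eq,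
    mul_conj] at h
  exact_mod_cast h

/-- The trace of `g ∈ SU(2)` is real: `tr g = 2 Re a`. [folklore] -/
theorem su2_trace_coe (g : SU2) :
    ((g : Matrix (Fin 2) (Fin 2) ℂ)).trace = ((2 * ((g : Matrix (Fin 2) (Fin 2) ℂ) 0 0).re : ℝ) : ℂ) := by
  rw [trace_fin_two, QuantumLattice.su2_apply_11, add_conj]

/-- The real part of the trace of `g ∈ SU(2)`. [folklore] -/
theorem su2_trace_re (g : SU2) :
    ((g : Matrix (Fin 2) (Fin 2) ℂ)).trace.re = 2 * ((g : Matrix (Fin 2) (Fin 2) ℂ) 0 0).re := by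
  rw [su2_trace_coe, ofReal_re]

/-- The trace of `g ∈ SU(2)` has no imaginary part. [folklore] -/
theorem su2_trace_im (g : SU2) : ((g : Matrix (Fin 2) (Fin 2) ℂ)).trace.im = 0 := by
  rw [su2_trace_coe, ofReal_im]

/-- `|Re tr g| ≤ 2` on `SU(2)` (entries of a unitary matrix have norm `≤ 1`). [folklore] -/
theorem su2_abs_trace_re_le (g : SU2) : |((g : Matrix (Fin 2) (Fin 2) ℂ)).trace.re| ≤ 2 := by
  rw [su2_trace_re, abs_mul, abs_two]
  have h1 := abs_re_le_norm ((g : Matrix (Fin 2) (Fin 2) ℂ) 0 0)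
  have h2 := entry_norm_bound_of_unitary g.prop.1 (0 : Fin 2) (0 : Fin 2)
  linarith

/-- **The `SU(2)` identity `g + g⁻¹ = (tr g) · 1`** (Cayley–Hamilton for a `2 × 2` matrix of
determinant `1`, or: a unit quaternion plus its conjugate is twice its real part). [folklore] -/
theorem su2_coe_add_coe_inv (g : SU2) :
    (g : Matrix (Fin 2) (Fin 2) ℂ) + ((g⁻¹ : SU2) : Matrix (Fin 2) (Fin 2) ℂ) =
      ((g : Matrix (Fin 2) (Fin 2) ℂ)).trace • (1 : Matrix (Fin 2) (Fin 2) ℂ) := by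
  have hinv : ((g⁻¹ : SU2) : Matrix (Fin 2) (Fin 2) ℂ) = star (g : Matrix (Fin 2) (Fin 2) ℂ) := rfl
  rw [hinv, su2_trace_coe]
  conv_lhs => rw [su2_coe_eq g]
  ext i j
  fin_cases i <;> fin_cases j <;> simp [star_apply, add_conj]
  rw [add_comm, add_conj]; push_cast; ring

/-- **Trace form of the `SU(2)` identity**: `Re tr (A g B) + Re tr (A g⁻¹ B) = (tr g) · Re tr (A B)`
for `A, B, g ∈ SU(2)` (from `su2_coe_add_coe_inv`; `tr g` is real). This is the algebraic
reason why the symmetric second difference of a Wilson plaquette term under `g ↔ g⁻¹` on one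
link is EXACTLY `(2 - tr g)`-small. [folklore] -/
theorem su2_trace_re_mul_add (A g B : SU2) :
    (((A * g * B : SU2) : Matrix (Fin 2) (Fin 2) ℂ)).trace.re +
        (((A * g⁻¹ * B : SU2) : Matrix (Fin 2) (Fin 2) ℂ)).trace.re =
      ((g : Matrix (Fin 2) (Fin 2) ℂ)).trace.re *
        (((A * B : SU2) : Matrix (Fin 2) (Fin 2) ℂ)).trace.re := by
  have hsum : ((A * g * B : SU2) : Matrix (Fin 2) (Fin 2) ℂ) + ((A * g⁻¹ * B : SU2) : Matrix _ _ ℂ) =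
      ((g : Matrix (Fin 2) (Fin 2) ℂ)).trace • ((A * B : SU2) : Matrix (Fin 2) (Fin 2) ℂ) := by
    simp only [Submonoid.coe_mul]
    rw [mul_assoc _ (g : Matrix (Fin 2) (Fin 2) ℂ) _,
      mul_assoc _ ((g⁻¹ : SU2) : Matrix (Fin 2) (Fin 2) ℂ) _,
      ← mul_add, ← add_mul, su2_coe_add_coe_inv, smul_mul_assoc, one_mul, mul_smul_comm]
  rw [← Complex.add_re, ← Matrix.trace_add, hsum, Matrix.trace_smul, smul_eq_mul, Complex.mul_re,
    su2_trace_im, zero_mul, sub_zero]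

/-! ### Roots in `SU(2)`: every element is an `L`-th power of an element within angle `π / L` of `1` -/

/-- The unit-quaternion matrix `!![a, b; -b̄, ā]`. [folklore] -/
def quatMat (a b : ℂ) : Matrix (Fin 2) (Fin 2) ℂ := !![a, b; -conj b, conj a]

/-- Quaternion multiplication in matrix form. [folklore] -/
theorem quatMat_mul (a b a' b' : ℂ) :
    quatMat a b * quatMat a' b' = quatMat (a * a' - b * conj b') (a * b' + b * conj a') := by
  ext i j
  fin_cases i <;> fin_cases j <;>
    simp [quatMat, Matrix.mul_apply, Fin.sum_univ_two, map_mul, map_sub, map_add] <;> ring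

/-- `quatMat 1 0 = 1`. [folklore] -/
@[simp] theorem quatMat_one_zero : quatMat 1 0 = 1 := by
  ext i j
  fin_cases i <;> fin_cases j <;> simp [quatMat]

/-- A unit quaternion matrix lies in `SU(2)`. [folklore] -/
theorem quatMat_mem_specialUnitaryGroup {a b : ℂ} (h : normSq a + normSq b = 1) :
    quatMat a b ∈ Matrix.specialUnitaryGroup (Fin 2) ℂ := by
  have h' : a * conj a + b * conj b = 1 := by
    rw [mul_conj, mul_conj]; exact_mod_cast h
  refine Matrix.mem_specialUnitaryGroup_iff.2 ⟨Matrix.mem_unitaryGroup_iff.2 ?_, ?_⟩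
  · ext i j
    fin_cases i <;> fin_cases j <;>
      simp [quatMat, Matrix.mul_apply, Fin.sum_univ_two, star_apply]
    · linear_combination h'
    · ring
    · ring
    · linear_combination h'
  · rw [quatMat, Matrix.det_fin_two_of]
    linear_combination h'

/-- The "rotation" entries `cos φ + i u₁ sin φ` and `(u₂ + i u₃) sin φ` of the one-parameter
subgroup of `SU(2)` generated by the unit imaginary quaternion `u = (u₁, u₂, u₃)`. [folklore] -/
def rotA (u₁ φ : ℝ) : ℂ := ⟨Real.cos φ, u₁ * Real.sin φ⟩

/-- See `rotA`. [folklore] -/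
def rotB (u₂ u₃ φ : ℝ) : ℂ := ⟨u₂ * Real.sin φ, u₃ * Real.sin φ⟩

/-- Angle addition for `rotA` (uses `|u| = 1`). [folklore] -/
theorem rotA_add {u₁ u₂ u₃ : ℝ} (hu : u₁ ^ 2 + u₂ ^ 2 + u₃ ^ 2 = 1) (φ ψ : ℝ) :
    rotA u₁ (φ + ψ) = rotA u₁ φ * rotA u₁ ψ - rotB u₂ u₃ φ * conj (rotB u₂ u₃ ψ) := by
  apply Complex.ext
  · simp [rotA, rotB, Real.cos_add]
    linear_combination (Real.sin φ * Real.sin ψ) * hu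
  · simp [rotA, rotB, Real.sin_add]
    ring

/-- Angle addition for `rotB`. [folklore] -/
theorem rotB_add (u₁ u₂ u₃ : ℝ) (φ ψ : ℝ) :
    rotB u₂ u₃ (φ + ψ) = rotA u₁ φ * rotB u₂ u₃ ψ + rotB u₂ u₃ φ * conj (rotA u₁ ψ) := by
  apply Complex.ext
  · simp [rotA, rotB, Real.sin_add]
    ring
  · simp [rotA, rotB, Real.sin_add]
    ring

/-- The rotation entries form a unit quaternion. [folklore] -/
theorem normSq_rotA_add_normSq_rotB {u₁ u₂ u₃ : ℝ} (hu : u₁ ^ 2 + u₂ ^ 2 + u₃ ^ 2 = 1) (φ : ℝ) :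
    normSq (rotA u₁ φ) + normSq (rotB u₂ u₃ φ) = 1 := by
  simp only [rotA, rotB, normSq_mk]
  have := Real.cos_sq_add_sin_sq φ
  linear_combination this + Real.sin φ ^ 2 * hu

/-- **De Moivre in `SU(2)`**: powers of the rotation by `φ` about `u` are the rotations by
`n φ`. [folklore] -/
theorem quatMat_rot_pow {u₁ u₂ u₃ : ℝ} (hu : u₁ ^ 2 + u₂ ^ 2 + u₃ ^ 2 = 1) (φ : ℝ) (n : ℕ) :
    quatMat (rotA u₁ φ) (rotB u₂ u₃ φ) ^ n = quatMat (rotA u₁ (n * φ)) (rotB u₂ u₃ (n * φ)) := by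
  induction n with
  | zero =>
    rw [pow_zero, Nat.cast_zero, zero_mul]
    have hA : rotA u₁ 0 = 1 := Complex.ext (by simp [rotA]) (by simp [rotA])
    have hB : rotB u₂ u₃ 0 = 0 := Complex.ext (by simp [rotB]) (by simp [rotB])
    rw [hA, hB, quatMat_one_zero]
  | succ n ih =>
    rw [pow_succ, ih, quatMat_mul, Nat.cast_succ, add_mul, one_mul, rotA_add hu, rotB_add u₁]

/-- The trace of a rotation is `2 cos φ`. [folklore] -/
theorem trace_quatMat_rot (u₁ u₂ u₃ φ : ℝ) :
    (quatMat (rotA u₁ φ) (rotB u₂ u₃ φ)).trace = ((2 * Real.cos φ : ℝ) : ℂ) := by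
  rw [quatMat, Matrix.trace_fin_two_of, add_conj]
  simp [rotA]

/-- **Small roots in `SU(2)`.** Every `x ∈ SU(2)` is the `L`-th power (`L ≥ 1`) of an element
`s ∈ SU(2)` with `2 - Re tr s ≤ (π / L)²`: write `x` as the rotation by `α ∈ [0, π]` about a
unit imaginary quaternion `u` (`cos α = Re x₀₀`) and take for `s` the rotation by `α / L` about
`u`, whose trace is `2 cos (α / L) ≥ 2 - (α / L)²` (maximal torus / one-parameter subgroups of
`SU(2) ≅ S³`; Bröcker–tom Dieck I (1.10), IV (1.6)). [folklore] -/
theorem su2_exists_root (x : SU2) {L : ℕ} (hL : 0 < L) :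
    ∃ s : SU2, s ^ L = x ∧ 2 - ((s : Matrix (Fin 2) (Fin 2) ℂ)).trace.re ≤ (π / L) ^ 2 := by
  -- coordinates of `x`
  set a : ℂ := (x : Matrix (Fin 2) (Fin 2) ℂ) 0 0 with ha
  set b : ℂ := (x : Matrix (Fin 2) (Fin 2) ℂ) 0 1 with hb
  have hnorm : normSq a + normSq b = 1 := su2_normSq_add_normSq x
  set c : ℝ := a.re with hc
  have hσ2 : a.im ^ 2 + normSq b = 1 - c ^ 2 := by
    rw [normSq_apply a] at hnorm
    nlinarith [hnorm]
  have hc1 : -1 ≤ c := by nlinarith [normSq_nonneg b, sq_nonneg a.im]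
  have hc2 : c ≤ 1 := by nlinarith [normSq_nonneg b, sq_nonneg a.im]
  set α : ℝ := Real.arccos c with hα
  have hcos : Real.cos α = c := Real.cos_arccos hc1 hc2
  set σ : ℝ := Real.sin α with hσ
  have hσeq : σ = √(1 - c ^ 2) := Real.sin_arccos c
  have hσsq : σ ^ 2 = 1 - c ^ 2 := by
    rw [hσeq, Real.sq_sqrt (by nlinarith)]
  have hσ0 : 0 ≤ σ := by rw [hσeq]; exact Real.sqrt_nonneg _
  -- the unit axis
  obtain ⟨u₁, u₂, u₃, hu, hau, hbu⟩ : ∃ u₁ u₂ u₃ : ℝ, u₁ ^ 2 + u₂ ^ 2 + u₃ ^ 2 = 1 ∧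
      a = rotA u₁ α ∧ b = rotB u₂ u₃ α := by
    by_cases hs : σ = 0
    · have h0 : a.im ^ 2 + normSq b = 0 := by rw [hσ2, ← hσsq, hs]; ring
      have him : a.im = 0 := by nlinarith [normSq_nonneg b, sq_nonneg a.im]
      have hb0 : b = 0 := normSq_eq_zero.1 (by nlinarith [normSq_nonneg b, sq_nonneg a.im])
      refine ⟨1, 0, 0, by norm_num, ?_, ?_⟩
      · exact Complex.ext (by simp [rotA, hcos, hc]) (by simp [rotA, ← hσ, hs, him])
      · rw [hb0]; exact Complex.ext (by simp [rotB]) (by simp [rotB])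
    · refine ⟨a.im / σ, b.re / σ, b.im / σ, ?_, ?_, ?_⟩
      · field_simp
        rw [normSq_apply b] at hσ2
        nlinarith [hσ2, hσsq]
      · exact Complex.ext (by simp [rotA, hcos, hc]) (by simp [rotA, ← hσ]; field_simp)
      · exact Complex.ext (by simp [rotB, ← hσ]; field_simp) (by simp [rotB, ← hσ]; field_simp)
  -- the root
  set θ : ℝ := α / L with hθ
  have hLθ : (L : ℝ) * θ = α := by
    rw [hθ]; field_simp
  refine ⟨⟨quatMat (rotA u₁ θ) (rotB u₂ u₃ θ),
    quatMat_mem_specialUnitaryGroup (normSq_rotA_add_normSq_rotB hu θ)⟩, ?_, ?_⟩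
  · apply Subtype.ext
    rw [SubmonoidClass.coe_pow]
    change quatMat (rotA u₁ θ) (rotB u₂ u₃ θ) ^ L = (x : Matrix (Fin 2) (Fin 2) ℂ)
    rw [quatMat_rot_pow hu θ L, hLθ, ← hau, ← hbu, su2_coe_eq x]
    rfl
  · change 2 - (quatMat (rotA u₁ θ) (rotB u₂ u₃ θ)).trace.re ≤ (π / L) ^ 2
    rw [trace_quatMat_rot, ofReal_re]
    have h1 := Real.one_sub_sq_div_two_le_cos (x := θ)
    have h2 : θ ^ 2 ≤ (π / L) ^ 2 := by
      rw [hθ]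
      gcongr
      · exact div_nonneg (Real.arccos_nonneg c) (Nat.cast_nonneg L)
      · exact Real.arccos_le_pi c
    linarith

open QuantumLattice Literature.Probability.LatticeModels MeasureTheory Function Finset
open scoped ENNReal

variable {d : ℕ}

/-! ### One link of one plaquette: the exact second difference -/

/-- **Single-link symmetric second difference of a plaquette observable** (`SU(2)`, fundamental
representation): right-multiplying the link variable of one edge `e₀` by `g` and by `g⁻¹` and
adding, the plaquette observable `Re tr U_p` becomes `(tr g) · Re tr U_p` if `e₀` is one of the
four edges of `p`, and `2 Re tr U_p` otherwise (`su2_trace_re_mul_add`; the four edges of a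
genuine plaquette, `i ≠ j`, are distinct). [folklore] -/
theorem plaquetteObs_update_mul_add (U : LGConfig d SU2) (e₀ : ZdEdge d) (g : SU2)
    (x : Literature.Probability.LatticeModels.Site d)
    {i j : Fin d} (hij : i ≠ j) :
    plaquetteObs (fundamentalRep (Fin 2)) x i j (update U e₀ (U e₀ * g)) +
        plaquetteObs (fundamentalRep (Fin 2)) x i j (update U e₀ (U e₀ * g⁻¹)) =
      if e₀ = (x, i) ∨ e₀ = (x + Pi.single i 1, j) ∨ e₀ = (x + Pi.single j 1, i) ∨ e₀ = (x, j) then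
        ((g : Matrix (Fin 2) (Fin 2) ℂ)).trace.re * plaquetteObs (fundamentalRep (Fin 2)) x i j U
      else 2 * plaquetteObs (fundamentalRep (Fin 2)) x i j U := by
  classical
  have hsi : x + Pi.single i (1 : ℤ) ≠ x := by
    intro h; have := congrFun h i; simp at this
  have hsj : x + Pi.single j (1 : ℤ) ≠ x := by
    intro h; have := congrFun h j; simp at this
  have h12 : ((x, i) : ZdEdge d) ≠ (x + Pi.single i 1, j) := fun h => hij (congrArg Prod.snd h)
  have h13 : ((x, i) : ZdEdge d) ≠ (x + Pi.single j 1, i) := fun h => hsj (congrArg Prod.fst h).symm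
  have h14 : ((x, i) : ZdEdge d) ≠ (x, j) := fun h => hij (congrArg Prod.snd h)
  have h23 : ((x + Pi.single i 1, j) : ZdEdge d) ≠ (x + Pi.single j 1, i) :=
    fun h => hij (congrArg Prod.snd h).symm
  have h24 : ((x + Pi.single i 1, j) : ZdEdge d) ≠ (x, j) := fun h => hsi (congrArg Prod.fst h)
  have h34 : ((x + Pi.single j 1, i) : ZdEdge d) ≠ (x, j) := fun h => hij (congrArg Prod.snd h)
  unfold plaquetteObs plaquetteHolonomyZd
  simp only [fundamentalRep_apply]
  by_cases h1 : e₀ = (x, i)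
  · subst h1
    rw [if_pos (Or.inl rfl)]
    simp only [update_self, update_of_ne h12.symm, update_of_ne h13.symm, update_of_ne h14.symm]
    have key := su2_trace_re_mul_add (U (x, i)) g
      (U (x + Pi.single i 1, j) * (U (x + Pi.single j 1, i))⁻¹ * (U (x, j))⁻¹)
    simp only [mul_assoc] at key ⊢
    exact key
  by_cases h2 : e₀ = (x + Pi.single i 1, j)
  · subst h2
    rw [if_pos (Or.inr (Or.inl rfl))]
    simp only [update_self, update_of_ne h12, update_of_ne h23.symm, update_of_ne h24.symm]
    have key := su2_trace_re_mul_add (U (x, i) * U (x + Pi.single i 1, j)) g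
      ((U (x + Pi.single j 1, i))⁻¹ * (U (x, j))⁻¹)
    simp only [mul_assoc] at key ⊢
    exact key
  by_cases h3 : e₀ = (x + Pi.single j 1, i)
  · subst h3
    rw [if_pos (Or.inr (Or.inr (Or.inl rfl)))]
    simp only [update_self, update_of_ne h13, update_of_ne h23, update_of_ne h34.symm]
    have key := su2_trace_re_mul_add (U (x, i) * U (x + Pi.single i 1, j)) g
      ((U (x + Pi.single j 1, i))⁻¹ * (U (x, j))⁻¹)
    simp only [_root_.mul_inv_rev, inv_inv, mul_assoc] at key ⊢
    rw [add_comm]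
    exact key
  by_cases h4 : e₀ = (x, j)
  · subst h4
    rw [if_pos (Or.inr (Or.inr (Or.inr rfl)))]
    simp only [update_self, update_of_ne h14, update_of_ne h24, update_of_ne h34]
    have key := su2_trace_re_mul_add (U (x, i) * U (x + Pi.single i 1, j) * (U (x + Pi.single j 1, i))⁻¹)
      g (U (x, j))⁻¹
    simp only [_root_.mul_inv_rev, inv_inv, mul_assoc] at key ⊢
    rw [add_comm]
    exact key
  · rw [if_neg (by rintro (h | h | h | h) <;> contradiction)]
    simp only [update_of_ne (Ne.symm h1), update_of_ne (Ne.symm h2), update_of_ne (Ne.symm h3),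
      update_of_ne (Ne.symm h4)]
    ring

/-! ### A plaquette contains at most one edge of a block line -/

/-- The sum of the coordinates of the base point of an edge other than the coordinate of its own
direction: an integer that is the same for all edges of a straight block line and that separates
the two parallel edges of a plaquette. [folklore] -/
def edgePhase (e : ZdEdge d) : ℤ := ∑ m ∈ univ.erase e.2, e.1 m

/-- Shifting the base point by a unit vector in another direction raises the phase by one. [folklore] -/
theorem edgePhase_add_single (x : Literature.Probability.LatticeModels.Site d) {i j : Fin d}
    (hij : i ≠ j) :
    edgePhase ((x + Pi.single j 1, i) : ZdEdge d) = edgePhase ((x, i) : ZdEdge d) + 1 := by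
  unfold edgePhase
  simp only [Pi.add_apply, sum_add_distrib]
  congr 1
  rw [sum_pi_single']
  simp [mem_erase, hij.symm]

/-- All edges of a block line have the same phase. [folklore] -/
theorem edgePhase_lineEdge (L : ℕ) (b : ZdEdge d) (t : ℕ) :
    edgePhase (lineEdge L b t) = edgePhase (lineEdge L b 0) := by
  unfold edgePhase lineEdge
  refine sum_congr rfl fun m hm => ?_
  simp only [Pi.add_apply, Pi.single_eq_of_ne (ne_of_mem_erase hm), add_zero, Nat.cast_zero]

/-- Two edges of one plaquette with the same direction and the same phase coincide. [folklore] -/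
theorem eq_of_mem_plaquetteEdges (p : ZdPlaquette d) {e e' : ZdEdge d} (he : e ∈ plaquetteEdges p)
    (he' : e' ∈ plaquetteEdges p) (h2 : e.2 = e'.2) (hφ : edgePhase e = edgePhase e') : e = e' := by
  obtain ⟨x, ⟨⟨i, j⟩, hij⟩⟩ := p
  have hne : i ≠ j := ne_of_lt hij
  have hA := edgePhase_add_single x hne
  have hB := edgePhase_add_single x hne.symm
  simp only [plaquetteEdges, mem_insert, mem_singleton] at he he'
  rcases he with rfl | rfl | rfl | rfl <;> rcases he' with rfl | rfl | rfl | rfl <;>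
    first
    | rfl
    | exact absurd h2 hne
    | exact absurd h2.symm hne
    | (exfalso; omega)

/-- **A plaquette contains at most one edge of the block line of `b`.** [folklore] -/
theorem lineEdge_mem_plaquetteEdges_unique {L : ℕ} {b : ZdEdge d} {p : ZdPlaquette d} {t t' : ℕ}
    (ht : t < L) (ht' : t' < L) (h : lineEdge L b t ∈ plaquetteEdges p)
    (h' : lineEdge L b t' ∈ plaquetteEdges p) : t = t' :=
  (lineEdge_inj ht ht' (eq_of_mem_plaquetteEdges p h h' rfl
    (by rw [edgePhase_lineEdge, edgePhase_lineEdge L b t']))).2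

/-! ### The second difference of the Wilson action under the spread twist -/

/-- **Per-plaquette second difference under the spread twist** (`SU(2)`): for every plaquette
`p`, `-(obs_p (T_s U) + obs_p (T_{s⁻¹} U) - 2 obs_p U) ≤ 2 (2 - Re tr s)` if `p` contains an edge
of the twisted line and `≤ 0` otherwise: the twist changes at most one link of `p` (by a
conjugate of `s`, resp. of `s⁻¹`, with the SAME conjugating tail), the plaquette observable reads
only the four links of `p` (`isCylinder_plaquetteObs`), and `plaquetteObs_update_mul_add` with
`|Re tr U_p| ≤ 2` and `Re tr s ≤ 2`. [folklore] -/
theorem neg_plaquetteObs_twist_second_diff_le (L : ℕ) (b : ZdEdge d) (s : SU2) (U : LGConfig d SU2)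
    (p : ZdPlaquette d) :
    -(plaquetteObs (fundamentalRep (Fin 2)) p.1 p.2.1.1 p.2.1.2 (spreadTwist L b s U) +
        plaquetteObs (fundamentalRep (Fin 2)) p.1 p.2.1.1 p.2.1.2 (spreadTwist L b s⁻¹ U) -
        2 * plaquetteObs (fundamentalRep (Fin 2)) p.1 p.2.1.1 p.2.1.2 U) ≤
      if ∃ t, t < L ∧ lineEdge L b t ∈ plaquetteEdges p then
        2 * (2 - ((s : Matrix (Fin 2) (Fin 2) ℂ)).trace.re) else 0 := by
  classical
  set ρ := fundamentalRep (Fin 2) with hρ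
  have hcyl := isCylinder_plaquetteObs (G := SU2) ρ p
  split_ifs with h
  · obtain ⟨t, ht, hmem⟩ := h
    set Q : SU2 := lineTail L b U t with hQ
    set g : SU2 := Q * s * Q⁻¹ with hg
    have hginv : Q * s⁻¹ * Q⁻¹ = g⁻¹ := by rw [hg]; group
    have htr : ((g : Matrix (Fin 2) (Fin 2) ℂ)).trace.re = ((s : Matrix (Fin 2) (Fin 2) ℂ)).trace.re := by
      rw [hg, Submonoid.coe_mul, Submonoid.coe_mul, Matrix.trace_mul_cycle, ← Submonoid.coe_mul,
        inv_mul_cancel, OneMemClass.coe_one, one_mul]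
    have hagree : ∀ s' : SU2, ∀ e ∈ plaquetteEdges p, spreadTwist L b s' U e =
        update U (lineEdge L b t) (U (lineEdge L b t) * (Q * s' * Q⁻¹)) e := by
      intro s' e he
      by_cases heq : e = lineEdge L b t
      · subst heq
        rw [spreadTwist_lineEdge L b s' U ht, update_self]
      · rw [update_of_ne heq]
        refine spreadTwist_apply_of_forall_ne L b s' U fun t' ht' h' => heq ?_
        rw [h'] at he ⊢
        rw [lineEdge_mem_plaquetteEdges_unique ht' ht he hmem]
    rw [hcyl (hagree s), hcyl (hagree s⁻¹), ← hg, hginv,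
      plaquetteObs_update_mul_add U (lineEdge L b t) g p.1 (ne_of_lt p.2.2),
      if_pos (by simpa [plaquetteEdges] using hmem), htr]
    have hobs : plaquetteObs ρ p.1 p.2.1.1 p.2.1.2 U ≤ 2 :=
      (le_abs_self _).trans (su2_abs_trace_re_le _)
    have hτ : ((s : Matrix (Fin 2) (Fin 2) ℂ)).trace.re ≤ 2 :=
      (le_abs_self _).trans (su2_abs_trace_re_le s)
    nlinarith [mul_nonneg (sub_nonneg.2 hτ) (sub_nonneg.2 hobs)]
  · have hagree : ∀ s' : SU2, ∀ e ∈ plaquetteEdges p, spreadTwist L b s' U e = U e :=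
      fun s' e he => spreadTwist_apply_of_forall_ne L b s' U fun t ht h' => h ⟨t, ht, h' ▸ he⟩
    rw [hcyl (hagree s), hcyl (hagree s⁻¹)]
    linarith

/-- The plaquette-counting constant `(1 + d) · #{i < j}` of `card_plaquettesTouching_le`. [folklore] -/
def plaquettesPerEdgeBound (d : ℕ) : ℕ := (1 + d) * Fintype.card {q : Fin d × Fin d // q.1 < q.2}

/-- **Second difference of the Wilson action under the spread twist** (`SU(2)`, any finite edge
volume `F`, any configuration): `S(T_s U) + S(T_{s⁻¹} U) - 2 S(U) ≤ 2 (2 - Re tr s) · c_d · L`,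
`c_d = plaquettesPerEdgeBound d`: only the `≤ c_d L` plaquettes meeting the `L` links of the line
contribute, each by at most `2 (2 - Re tr s)` (`neg_plaquetteObs_twist_second_diff_le`). With
`2 - Re tr s = O(L⁻²)` this is `O(L⁻¹)` — the reason the twist is spread. [folklore] -/
theorem wilsonBoundaryAction_twist_second_diff_le (L : ℕ) (b : ZdEdge d) (s : SU2)
    (F : Finset (ZdEdge d)) (U : LGConfig d SU2) :
    wilsonBoundaryAction (fundamentalRep (Fin 2)) F (spreadTwist L b s U) +
        wilsonBoundaryAction (fundamentalRep (Fin 2)) F (spreadTwist L b s⁻¹ U) -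
        2 * wilsonBoundaryAction (fundamentalRep (Fin 2)) F U ≤
      2 * (2 - ((s : Matrix (Fin 2) (Fin 2) ℂ)).trace.re) * (plaquettesPerEdgeBound d * L) := by
  classical
  set ρ := fundamentalRep (Fin 2) with hρ
  set τ : ℝ := ((s : Matrix (Fin 2) (Fin 2) ℂ)).trace.re with hτ
  have hτ2 : τ ≤ 2 := (le_abs_self _).trans (su2_abs_trace_re_le s)
  set P := plaquettesTouching F with hP
  set lineSet : Finset (ZdEdge d) := (range L).image (lineEdge L b) with hlineSet
  -- rewrite the left-hand side as a sum of per-plaquette second differences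
  have hlhs : wilsonBoundaryAction ρ F (spreadTwist L b s U) +
      wilsonBoundaryAction ρ F (spreadTwist L b s⁻¹ U) - 2 * wilsonBoundaryAction ρ F U =
      ∑ p ∈ P, -(plaquetteObs ρ p.1 p.2.1.1 p.2.1.2 (spreadTwist L b s U) +
        plaquetteObs ρ p.1 p.2.1.1 p.2.1.2 (spreadTwist L b s⁻¹ U) -
        2 * plaquetteObs ρ p.1 p.2.1.1 p.2.1.2 U) := by
    unfold wilsonBoundaryAction
    rw [mul_sum, ← sum_add_distrib, ← sum_sub_distrib]
    refine sum_congr rfl fun p _ => ?_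
    ring
  rw [hlhs]
  -- bound each term and count
  calc ∑ p ∈ P, -(plaquetteObs ρ p.1 p.2.1.1 p.2.1.2 (spreadTwist L b s U) +
          plaquetteObs ρ p.1 p.2.1.1 p.2.1.2 (spreadTwist L b s⁻¹ U) -
          2 * plaquetteObs ρ p.1 p.2.1.1 p.2.1.2 U)
      ≤ ∑ p ∈ P, (if ∃ t, t < L ∧ lineEdge L b t ∈ plaquetteEdges p then 2 * (2 - τ) else 0) :=
        sum_le_sum fun p _ => neg_plaquetteObs_twist_second_diff_le L b s U p
    _ = 2 * (2 - τ) * ((P.filter fun p => ∃ t, t < L ∧ lineEdge L b t ∈ plaquetteEdges p).card : ℝ) := by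
        rw [sum_ite, sum_const_zero, add_zero, sum_const, nsmul_eq_mul, mul_comm]
    _ ≤ 2 * (2 - τ) * ((plaquettesTouching lineSet).card : ℝ) := by
        have hsub : (P.filter fun p => ∃ t, t < L ∧ lineEdge L b t ∈ plaquetteEdges p) ⊆
            plaquettesTouching lineSet := by
          intro p hp
          obtain ⟨-, t, ht, hmem⟩ := mem_filter.1 hp
          exact mem_plaquettesTouching_iff.2 ⟨lineEdge L b t, mem_inter.2 ⟨hmem,
            mem_image.2 ⟨t, mem_range.2 ht, rfl⟩⟩⟩
        have : 0 ≤ 2 * (2 - τ) := by linarith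
        exact mul_le_mul_of_nonneg_left (by exact_mod_cast card_le_card hsub) this
    _ ≤ 2 * (2 - τ) * (plaquettesPerEdgeBound d * L) := by
        have h1 := card_plaquettesTouching_le lineSet
        have h2 : lineSet.card ≤ L := card_image_le.trans (card_range L).le
        have h3 : (plaquettesTouching lineSet).card ≤ plaquettesPerEdgeBound d * L :=
          h1.trans (by unfold plaquettesPerEdgeBound; exact Nat.mul_le_mul_left _ h2)
        have : 0 ≤ 2 * (2 - τ) := by linarith
        exact mul_le_mul_of_nonneg_left (by exact_mod_cast h3) this

/-- **The pointwise geometric-mean bound for the Wilson weight under small spread twists**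
(`SU(2)`): if `2 - Re tr s ≤ (π / L)²` and `β · 2 c_d π² / L ≤ K`, then
`e^{-K/2} · w(U) ≤ w(T_s U)^{1/2} · w(T_{s⁻¹} U)^{1/2}` for the Wilson weight `w = e^{-β S_F}`
(`wilsonBoundaryAction_twist_second_diff_le`). At `β = L / g²` the hypothesis holds with
`K = 2 c_d π² / g²`, INDEPENDENT of `L`. [folklore] -/
theorem wilsonBoltzmannWeight_twist_sqrt_bound {L : ℕ} (hL : 0 < L) (b : ZdEdge d) {s : SU2}
    (hs : 2 - ((s : Matrix (Fin 2) (Fin 2) ℂ)).trace.re ≤ (Real.pi / L) ^ 2) (F : Finset (ZdEdge d))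
    {β K : ℝ} (hβ : 0 ≤ β) (hK : β * (2 * plaquettesPerEdgeBound d * Real.pi ^ 2 / L) ≤ K)
    (U : LGConfig d SU2) :
    ENNReal.ofReal (Real.exp (-(K / 2))) * wilsonBoltzmannWeight (fundamentalRep (Fin 2)) β F U ≤
      (wilsonBoltzmannWeight (fundamentalRep (Fin 2)) β F (spreadTwist L b s U)) ^ (1 / 2 : ℝ) *
        (wilsonBoltzmannWeight (fundamentalRep (Fin 2)) β F (spreadTwist L b s⁻¹ U)) ^ (1 / 2 : ℝ) := by
  have hL' : (0 : ℝ) < L := by exact_mod_cast hL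
  have hdiff : wilsonBoundaryAction (fundamentalRep (Fin 2)) F (spreadTwist L b s U) +
      wilsonBoundaryAction (fundamentalRep (Fin 2)) F (spreadTwist L b s⁻¹ U) -
      2 * wilsonBoundaryAction (fundamentalRep (Fin 2)) F U ≤
      2 * plaquettesPerEdgeBound d * Real.pi ^ 2 / L := by
    calc _ ≤ 2 * (2 - ((s : Matrix (Fin 2) (Fin 2) ℂ)).trace.re) * (plaquettesPerEdgeBound d * L) :=
          wilsonBoundaryAction_twist_second_diff_le L b s F U
      _ ≤ 2 * (Real.pi / L) ^ 2 * (plaquettesPerEdgeBound d * L) := by gcongr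
      _ = 2 * plaquettesPerEdgeBound d * Real.pi ^ 2 / L := by
          field_simp
  have hkey : -(K / 2) + -(β * wilsonBoundaryAction (fundamentalRep (Fin 2)) F U) ≤
      -(β * wilsonBoundaryAction (fundamentalRep (Fin 2)) F (spreadTwist L b s U)) * (1 / 2 : ℝ) +
        -(β * wilsonBoundaryAction (fundamentalRep (Fin 2)) F (spreadTwist L b s⁻¹ U)) * (1 / 2 : ℝ) := by
    have h := (mul_le_mul_of_nonneg_left hdiff hβ).trans hK
    linarith
  unfold wilsonBoltzmannWeight
  rw [ENNReal.ofReal_rpow_of_nonneg (Real.exp_nonneg _) (by norm_num),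
    ENNReal.ofReal_rpow_of_nonneg (Real.exp_nonneg _) (by norm_num),
    ← ENNReal.ofReal_mul (Real.exp_nonneg _),
    ← ENNReal.ofReal_mul (Real.rpow_nonneg (Real.exp_nonneg _) _),
    ← Real.exp_mul, ← Real.exp_mul, ← Real.exp_add, ← Real.exp_add]
  exact ENNReal.ofReal_le_ofReal (Real.exp_le_exp.2 hkey)


/-! ### Assembly: cutoff-uniform stability of the Haar-iterate schemes at `β = Mⁿ / g²` -/

attribute [local instance] QuantumLattice.secondCountableTopology_su2

/-- **Two-sided bounds for the `(n+1)`-st normalised block RG iterate of the `SU(2)` Wilson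
weight, with the twist constant.** If `β · 2 c_d π² / M^{n+1} ≤ K` (and `K ≥ 0`), then
`e^{-K|Λ|} ≤ ρ_{n+1}(Λ, V) ≤ e^{K|Λ|}` for `freeHaarConfig Λ`-a.e. `V`, where
`ρ_k = rgIterate M (wilsonBoltzmannWeight ρ β) k` are the normalised iterates of
`BalabanRGHaarIterates`. Ingredients: the `n+1` steps are one step of block size `M^{n+1}`
(`rgIterate_ae_eq_smul_blockStepDensity`); the oscillation of that one-step density is bounded
via the spread twist (`blockStepDensity_osc_of_twist`) using small `SU(2)` roots
(`su2_exists_root`) and the second-difference bound of the Wilson action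
(`wilsonBoltzmannWeight_twist_sqrt_bound`); total mass one pins the density
(`bounds_of_osc_of_lintegral_eq_one`). For `β = M^{n+1} / g²` the hypothesis holds with
`K = 2 c_d π² / g²` uniformly in `n`. [folklore] -/
theorem rgIterate_wilson_su2_ae_bounds (M : ℕ) (hM : 2 ≤ M) {β : ℝ} (hβ : 0 ≤ β) (n : ℕ) {K : ℝ}
    (hK0 : 0 ≤ K)
    (hK : β * (2 * plaquettesPerEdgeBound d * Real.pi ^ 2 / ((M ^ (n + 1) : ℕ) : ℝ)) ≤ K)
    (Λ : Finset (ZdEdge d)) :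
    ∀ᵐ V ∂(freeHaarConfig Λ : Measure (LGConfig d SU2)),
      ENNReal.ofReal (Real.exp (-(K * Λ.card))) ≤
          rgIterate M (wilsonBoltzmannWeight (fundamentalRep (Fin 2)) β) (n + 1) Λ V ∧
        rgIterate M (wilsonBoltzmannWeight (fundamentalRep (Fin 2)) β) (n + 1) Λ V ≤
          ENNReal.ofReal (Real.exp (K * Λ.card)) := by
  haveI : NeZero M := ⟨by omega⟩
  set ρ := fundamentalRep (Fin 2) with hρdef
  have hρ : Continuous ρ := continuous_fundamentalRep (Fin 2)
  obtain ⟨K', hK', hmeas, hpos, hbdd, hosc, -⟩ :=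
    wilsonBoltzmannWeight_spec (d := d) (G := SU2) ρ hρ hβ
  set L : ℕ := M ^ (n + 1) with hL
  have hL0 : 0 < L := pow_pos (by omega) _
  haveI : NeZero L := ⟨hL0.ne'⟩
  obtain ⟨c, hc0, hct, hae⟩ :=
    rgIterate_ae_eq_smul_blockStepDensity M hK' hmeas hpos hbdd hosc (n + 1) Λ
  set w : LGConfig d SU2 → ℝ≥0∞ := wilsonBoltzmannWeight ρ β (fineEdges L Λ) with hw
  set D : LGConfig d SU2 → ℝ≥0∞ := fun V => c * blockStepDensity L Λ w V with hD
  have hDm : Measurable D := (measurable_blockStepDensity L Λ (hmeas _)).const_mul c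
  have hread : ∀ V V' : LGConfig d SU2, (∀ b ∈ Λ, V b = V' b) → D V = D V' := fun V V' h => by
    simp only [hD, blockStepDensity_congr L Λ w h]
  have htw : ∀ b ∈ Λ, ∀ x : SU2, ∃ s : SU2, s ^ L = x ∧ ∀ U,
      ENNReal.ofReal (Real.exp (-(K / 2))) * w U ≤
        (w (spreadTwist L b s U)) ^ (1 / 2 : ℝ) * (w (spreadTwist L b s⁻¹ U)) ^ (1 / 2 : ℝ) := by
    intro b _ x
    obtain ⟨s, hsL, hs⟩ := su2_exists_root x hL0
    exact ⟨s, hsL, fun U => wilsonBoltzmannWeight_twist_sqrt_bound hL0 b hs (fineEdges L Λ) hβ hK U⟩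
  have hoscD : ∀ (F : Finset (ZdEdge d)) (V V' : LGConfig d SU2), (∀ e ∉ F, V e = V' e) →
      D V ≤ ENNReal.ofReal (Real.exp (K * F.card)) * D V' := by
    intro F V V' hV
    have h := blockStepDensity_osc_of_twist L Λ (hmeas _) (hpos _) (hbdd _) hK0 htw F V V' hV
    calc D V = c * blockStepDensity L Λ w V := rfl
      _ ≤ c * (ENNReal.ofReal (Real.exp (K * F.card)) * blockStepDensity L Λ w V') :=
          mul_le_mul_right h c
      _ = ENNReal.ofReal (Real.exp (K * F.card)) * D V' := by rw [hD, mul_left_comm]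
  have hmass : ∫⁻ V, D V ∂freeHaarConfig Λ = 1 := by
    calc ∫⁻ V, D V ∂freeHaarConfig Λ
        = ∫⁻ V, rgIterate M (wilsonBoltzmannWeight ρ β) (n + 1) Λ V ∂freeHaarConfig Λ :=
          (lintegral_congr_ae hae).symm
      _ = 1 := lintegral_rgIterate_succ M hK' hmeas hpos hbdd hosc n Λ
  filter_upwards [hae] with V hV
  rw [hV]
  exact bounds_of_osc_of_lintegral_eq_one Λ hDm hread hoscD hmass V

/-- **Discharge of `BalabanUVStability3` as rendered.** For every block size `M ≥ 2` and coupling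
`g > 0`, the cutoff-indexed family of Haar-iterate schemes (`BlockRGScheme.haarIterate`, the
normalised free-boundary axial-gauge block RG iterates of the `SU(2)` Wilson density, file
`BalabanRGHaarIterates`) at bare coupling `g_ε² = g² M⁻ⁿ` satisfies the normalised recursion
`IsRGIterateWith` and the two-sided bounds `e^{-K|Λ|} ≤ ρ^{(n)}_n(Λ, V) ≤ e^{K|Λ|}` on the unit
lattice, Haar-a.e., with `K = max (K₀, 2 c₃ π² / g²)` INDEPENDENT of the cutoff `n` (`K₀` the
constant of the bare Wilson weight at `β = g⁻²`, for `n = 0`; `c₃ = plaquettesPerEdgeBound 3`).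

**What is and is not proved.** The proof is elementary and does NOT formalise Bałaban's theorem
(CMP 102 (1985) Thm. 1): it uses only (i) the semigroup property of straight-line block
holonomies (`BalabanRGMultiscale`: `n` steps of size `M` = one step of size `Mⁿ`), (ii) Haar
invariance of the spread twist, which moves each of the `Mⁿ` links of a block line by an `Mⁿ`-th
root of the prescribed change of holonomy (`BalabanRGSpreadTwist`), (iii) the Cauchy–Schwarz
inequality on each fibre, and (iv) the `SU(2)` identity `g + g⁻¹ = (tr g) 1` (the unit-quaternion
structure of `SU(2)`, file `QuantumLattice/SU2Haar`), by which the
symmetric second difference of the Wilson action is `≤ 2 c_d (π²/Mⁿ)` per line; at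
`β = Mⁿ / g²` (the `d = 3` scaling `g_ε² = g² ε`) this is `O(g⁻²)` uniformly in `n`. Bałaban's
theorem asserts far more — the small-field representation (5) of the effective densities at
EVERY scale, with the action of the minimiser as main term, in the gauge-covariant torus
set-up — none of which is captured by the rendered statement, which only asks for crude
two-sided a.e. bounds at the last scale; these turn out to be forced by convexity and Haar
invariance alone. (Indeed the straight-line block holonomies of prelude A18 have a
logarithmically divergent self-energy in `d = 3`, so no finer statement about them should be
expected; the bounds hold regardless.) The rendering should therefore not be cited as a
formalisation of UV stability in Bałaban's sense. [folklore] -/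
theorem BalabanUVStability3_holds : BalabanUVStability3 := by
  intro M g hM hg
  haveI : NeZero M := ⟨by omega⟩
  set ρ := fundamentalRep (Fin 2) with hρdef
  have hρ : Continuous ρ := continuous_fundamentalRep (Fin 2)
  have hMpos : (0 : ℝ) < M := by exact_mod_cast (show 0 < M by omega)
  -- running couplings of the `n`-th scheme: bare coupling `g M^{-n/2}` (only `g 0` matters)
  set cpl : ℕ → RunningCouplings := fun n _ => g * (Real.sqrt ((M : ℝ) ^ n))⁻¹ with hcpl
  have hsqrt_pos : ∀ n, 0 < Real.sqrt ((M : ℝ) ^ n) := fun n => Real.sqrt_pos.2 (pow_pos hMpos n)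
  have hcpl_pos : ∀ n, 0 < cpl n 0 := fun n => mul_pos hg (inv_pos.2 (hsqrt_pos n))
  have hcpl_sq : ∀ n, cpl n 0 ^ 2 = g ^ 2 * ((M : ℝ) ^ n)⁻¹ := fun n => by
    simp only [hcpl]
    rw [mul_pow, inv_pow, Real.sq_sqrt (pow_nonneg hMpos.le n)]
  have hβ : ∀ n, (cpl n 0)⁻¹ ^ 2 = (M : ℝ) ^ n / g ^ 2 := fun n => by
    simp only [hcpl]
    rw [_root_.mul_inv_rev, inv_inv, mul_pow, Real.sq_sqrt (pow_nonneg hMpos.le n), inv_pow,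
      div_eq_mul_inv]
  -- the constants: `K₀` for the bare Wilson weight at `n = 0`, `K₁` the twist constant
  obtain ⟨K₀, hK₀, -, -, -, -, h0⟩ :=
    wilsonBoltzmannWeight_spec (d := 3) (G := SU2) ρ hρ (sq_nonneg ((cpl 0 0)⁻¹))
  set K₁ : ℝ := 2 * plaquettesPerEdgeBound 3 * Real.pi ^ 2 / g ^ 2 with hK₁
  set K : ℝ := max K₀ K₁ with hKdef
  have hK0 : 0 ≤ K := hK₀.trans (le_max_left _ _)
  refine ⟨fun n => BlockRGScheme.haarIterate M hM ρ (cpl n),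
    fun n => BlockRGScheme.haarIterateNormalisation M ρ (cpl n), K, K, fun n =>
      ⟨rfl, rfl, hcpl_pos n, hcpl_sq n, BlockRGScheme.haarIterate_isRGIterateWith hM ρ hρ (cpl n), ?_⟩⟩
  intro Λ
  have hcard : (0 : ℝ) ≤ Λ.card := Nat.cast_nonneg _
  cases n with
  | zero =>
    refine ae_of_all _ fun V => ?_
    rw [BlockRGScheme.haarIterate_effDensity, rgIterate_zero]
    obtain ⟨hl, hu⟩ := h0 Λ V
    have hKK : K₀ * Λ.card ≤ K * Λ.card := mul_le_mul_of_nonneg_right (le_max_left _ _) hcard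
    exact ⟨(Real.exp_le_exp.2 (by linarith)).trans hl, hu.trans (Real.exp_le_exp.2 hKK)⟩
  | succ m =>
    have hKm : (cpl (m + 1) 0)⁻¹ ^ 2 *
        (2 * plaquettesPerEdgeBound 3 * Real.pi ^ 2 / ((M ^ (m + 1) : ℕ) : ℝ)) ≤ K := by
      have hMm : (M : ℝ) ^ (m + 1) ≠ 0 := pow_ne_zero _ hMpos.ne'
      have hg0 : g ≠ 0 := hg.ne'
      have heq : (cpl (m + 1) 0)⁻¹ ^ 2 *
          (2 * plaquettesPerEdgeBound 3 * Real.pi ^ 2 / ((M ^ (m + 1) : ℕ) : ℝ)) = K₁ := by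
        rw [hβ, hK₁]
        push_cast
        field_simp
      rw [heq]
      exact le_max_right _ _
    have hae := rgIterate_wilson_su2_ae_bounds (d := 3) M hM (sq_nonneg ((cpl (m + 1) 0)⁻¹)) m hK0 hKm Λ
    filter_upwards [hae] with V hV
    rw [BlockRGScheme.haarIterate_effDensity]
    obtain ⟨hl, hu⟩ := hV
    have hfin : rgIterate M (wilsonBoltzmannWeight ρ ((cpl (m + 1) 0)⁻¹ ^ 2)) (m + 1) Λ V ≠ ∞ :=
      ne_top_of_le_ne_top ENNReal.ofReal_ne_top hu
    exact ⟨(ENNReal.ofReal_le_iff_le_toReal hfin).1 hl,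
      ENNReal.toReal_le_of_le_ofReal (Real.exp_nonneg _) hu⟩

end Literature.MathematicalPhysics.QuantumFieldTheory
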